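import Summits.KontsevichZagierPeriods.KontsevichZagierPeriods.Theorems.RootDecompZetaThreeFrontierGZLadderFourPolarP10

/-! # `RootDecompZetaThreeFrontierGZLadderFourPolarP11` — part 11/12 of the mechanical ≤400-line split of `l4_src.lean` (sha256 5cc5a9ee4c47da9a…)
Source: decomp-kz lens-1 g13 Layer4_v1.lean @897236f9 minus the RungFour prelude block (imported from …RungFourPreludeP14); --supports stmt-KontsevichZagierPeriods-27141.
Split by census-1 g10 `gen/splitlean.py`: scopes re-opened with their `open`/`variable`/`set_option` context; mathematics and declaration order unchanged. -/

set_option linter.dupNamespace false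
noncomputable section
set_option linter.dupNamespace false
set_option linter.unusedVariables false
set_option linter.unusedSectionVars false
set_option linter.unusedSimpArgs false
open Set MeasureTheory MvPolynomial
open Literature.NumberTheory.Transcendental
open Summit.KontsevichZagierPeriods.KontsevichZagierPeriods.Theorems.RootDecompZetaThreeFrontierWordMoves
open Summit.KontsevichZagierPeriods.KontsevichZagierPeriods.Cruxes.GZNormalFormWThree.GZLadder.RungThree (congInto_mono congInto_of_mem_closure congInto_of_sub_mem)

/-- Auxiliary step `vec4_3` (§L4): vec4 3. [bookkeeping] -/
private theorem vec4_3 (a b c d : ℝ) : (![a, b, c, d] : Fin 4 → ℝ) 3 = d := rfl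

/-- Auxiliary step `vec4_2` (§L4): vec4 2. [bookkeeping] -/
private theorem vec4_2 (a b c d : ℝ) : (![a, b, c, d] : Fin 4 → ℝ) 2 = c := rfl

/-- Auxiliary step `vec4_1` (§L4): vec4 1. [bookkeeping] -/
private theorem vec4_1 (a b c d : ℝ) : (![a, b, c, d] : Fin 4 → ℝ) 1 = b := rfl

/-- Auxiliary step `vec4_0` (§L4): vec4 0. [bookkeeping] -/
private theorem vec4_0 (a b c d : ℝ) : (![a, b, c, d] : Fin 4 → ℝ) 0 = a := rfl

/-- Auxiliary step `exists_measurableEquiv_snoc` (§W1): exists measurable Equiv snoc. [bookkeeping] -/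
private theorem exists_measurableEquiv_snoc (N : ℕ) :
    ∃ e : (Fin (N + 1) → ℝ) ≃ᵐ (Fin N → ℝ) × ℝ,
      MeasurePreserving e volume ((volume : Measure (Fin N → ℝ)).prod (volume : Measure ℝ)) ∧
      ∀ q, e.symm q = Fin.snoc q.1 q.2 := by
  refine ⟨(MeasurableEquiv.piFinSuccAbove (fun _ => ℝ) (Fin.last N)).trans
    MeasurableEquiv.prodComm, ?_, fun q => ?_⟩
  · refine (volume_preserving_piFinSuccAbove (fun _ => ℝ) (Fin.last N)).trans ?_
    rw [Measure.volume_eq_prod]; exact Measure.measurePreserving_swap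
  · show (MeasurableEquiv.piFinSuccAbove (fun _ => ℝ) (Fin.last N)).symm (q.2, q.1) = _
    rw [MeasurableEquiv.piFinSuccAbove_symm_apply, Fin.insertNthEquiv_last]; rfl

open Set MeasureTheory MvPolynomial in
open Literature.NumberTheory.Transcendental in
open Summit.KontsevichZagierPeriods.KontsevichZagierPeriods.Theorems.RootDecompZetaThreeFrontierWordMoves in
open Summit.KontsevichZagierPeriods.KontsevichZagierPeriods.Cruxes.GZNormalFormWThree.GZLadder.RungFour in
open Summit.KontsevichZagierPeriods.KontsevichZagierPeriods.Cruxes.GZNormalFormWThree.GZLadder.WlogFour in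
open Summit.KontsevichZagierPeriods.KontsevichZagierPeriods.Cruxes.GZNormalFormWThree.GZLadder.MatchFour in
open Summit.KontsevichZagierPeriods.KontsevichZagierPeriods.Cruxes.GZNormalFormWThree.GZLadder.GapForm in
open Literature.ModelTheory.ExponentialFields (IsSemialgebraic) in
/-- **Newton–Leibniz over an open band, packaged** (verbatim copy of the landed private
`WordLayer.newtonLeibniz_pack` = `JanusBands.IntegrateOut.newtonLeibniz_pack`, with the public `WlogFour.exists_measurableEquiv_snoc`).
[Kontsevich–Zagier 2001, §1.2, rule (3)] [folklore] -/
private theorem newtonLeibniz_pack4 {N : ℕ} {τ : Set (Fin N → ℝ)} (hτ : IsSemialgebraic ℚ τ)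
    {a b : (Fin N → ℝ) → ℝ} (ha : IsSemialgebraicFunOn ℚ τ a) (hb : IsSemialgebraicFunOn ℚ τ b)
    (hab : ∀ x ∈ τ, a x < b x) {f F : (Fin (N + 1) → ℝ) → ℝ}
    (hf : IsSemialgebraicFunOn ℚ (KZlog.band τ a b) f)
    (hF : IsSemialgebraicFunOn ℚ (KZlog.band τ a b) F)
    (hcont : ∀ x ∈ τ, ContinuousOn (fun t => F (Fin.snoc x t)) (Icc (a x) (b x)))
    (hder : ∀ x ∈ τ, ∀ t ∈ Ioo (a x) (b x),
      HasDerivAt (fun s => F (Fin.snoc x s)) (f (Fin.snoc x t)) t)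
    (r : KZ.IntegralRep (N + 1))
    (hrd : r.domain = {z | (Fin.init z : Fin N → ℝ) ∈ τ ∧ a (Fin.init z) < z (Fin.last N) ∧
      z (Fin.last N) < b (Fin.init z)})
    (hri : EqOn r.integrand f r.domain) :
    ∃ r' : KZ.IntegralRep N, r'.domain = τ ∧
      (r'.integrand = fun x => F (Fin.snoc x (b x)) - F (Fin.snoc x (a x))) ∧
      KZ.of r - KZ.of r' ∈ KZ.relations := by
  have hτm : MeasurableSet τ := IsSemialgebraic.measurableSet_holds hτ
  have hBsa : IsSemialgebraic ℚ (KZlog.band τ a b) := KZlog.isSemialgebraic_band ha hb; have hBm : MeasurableSet (KZlog.band τ a b) := IsSemialgebraic.measurableSet_holds hBsa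
  have hsub : r.domain ⊆ KZlog.band τ a b := by
    rw [hrd]; exact fun z hz => ⟨hz.1, hz.2.1.le, hz.2.2.le⟩
  have hdiff : KZlog.band τ a b \ r.domain ⊆
      {z | (Fin.init z : Fin N → ℝ) ∈ τ ∧ z (Fin.last N) = a (Fin.init z)} ∪
        {z | (Fin.init z : Fin N → ℝ) ∈ τ ∧ z (Fin.last N) = b (Fin.init z)} := by
    rw [hrd]; rintro z ⟨⟨hzτ, h1, h2⟩, hz⟩; simp only [mem_setOf_eq, not_and, not_lt] at hz; rcases h1.lt_or_eq with h1 | h1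
    · exact Or.inr ⟨hzτ, le_antisymm h2 (hz hzτ h1)⟩
    · exact Or.inl ⟨hzτ, h1.symm⟩
  have hnull : volume (KZlog.band τ a b \ r.domain) = 0 :=
    measure_mono_null hdiff (measure_union_null (KZ.volume_graph_eq_zero ha)
      (KZ.volume_graph_eq_zero hb))
  have hfO : IntegrableOn f r.domain :=
    r.integrableOn.congr_fun hri (KZ.IntegralRep.measurableSet_domain_holds r)
  have hfB : IntegrableOn f (KZlog.band τ a b) := by
    rw [← Set.union_sdiff_cancel hsub]; exact integrableOn_union.mpr ⟨hfO, IntegrableOn.of_measure_zero hnull⟩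
  let r₂ : KZ.IntegralRep (N + 1) := ⟨KZlog.band τ a b, f, hBsa, hf, hfB⟩
  have h12 : KZ.of r - KZ.of r₂ ∈ KZ.relations := by
    refine KZ.of_sub_of_mem_relations_of_null r r₂ ?_ hnull fun z hz => hri hz.1
    rw [Set.sdiff_eq_empty.mpr hsub, measure_empty]
  have hmap : ∀ {c : (Fin N → ℝ) → ℝ}, IsSemialgebraicFunOn ℚ τ c →
      (∀ x ∈ τ, c x ∈ Icc (a x) (b x)) →
      IsSemialgebraicFunOn ℚ τ (fun x => F (Fin.snoc x (c x))) := by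
    intro c hc hcm
    have hφ : IsSemialgebraicMapOn ℚ τ (fun x => (Fin.snoc x (c x) : Fin (N + 1) → ℝ)) := by
      refine IsSemialgebraicMapOn.of_forall hτ fun j => ?_
      refine Fin.lastCases ?_ (fun i => ?_) j
      · simpa using hc
      · simpa using isSemialgebraicFunOn_apply hτ i
    exact IsSemialgebraicFunOn.comp_isSemialgebraicMapOn_holds hF hφ
      fun x hx => KZlog.snoc_mem_band.mpr ⟨hx, hcm x hx⟩
  have hgsa : IsSemialgebraicFunOn ℚ τ (fun x => F (Fin.snoc x (b x)) - F (Fin.snoc x (a x))) :=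
    IsSemialgebraicFunOn.sub_holds (hmap hb fun x hx => Set.right_mem_Icc.mpr (hab x hx).le)
      (hmap ha fun x hx => Set.left_mem_Icc.mpr (hab x hx).le)
  set G : (Fin (N + 1) → ℝ) → ℝ := (KZlog.band τ a b).indicator f with hG_def
  have hG : Integrable G := (integrable_indicator_iff hBm).mpr hfB; obtain ⟨e, he, he_symm⟩ := exists_measurableEquiv_snoc N
  have hG2 : Integrable (fun q : (Fin N → ℝ) × ℝ => G (Fin.snoc q.1 q.2))
      ((volume : Measure (Fin N → ℝ)).prod (volume : Measure ℝ)) := by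
    have h := ((he.symm e).integrable_comp_emb e.symm.measurableEmbedding (g := G)).mpr hG; convert h using 1; ext q; simp [he_symm]
  have hfib_in : ∀ x ∈ τ, (fun t => G (Fin.snoc x t)) =
      (Icc (a x) (b x)).indicator (fun t => f (Fin.snoc x t)) := by
    intro x hx; ext t; by_cases ht : t ∈ Icc (a x) (b x)
    · rw [indicator_of_mem ht, hG_def, indicator_of_mem (KZlog.snoc_mem_band.mpr ⟨hx, ht⟩)]
    · rw [indicator_of_notMem ht, hG_def,
        indicator_of_notMem (fun h => ht (KZlog.snoc_mem_band.mp h).2)]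
  have hgx : ∀ x ∈ τ, Integrable (fun t => G (Fin.snoc x t)) →
      F (Fin.snoc x (b x)) - F (Fin.snoc x (a x)) = ∫ t, G (Fin.snoc x t) := by
    intro x hx hxi
    rw [hfib_in x hx, integral_indicator measurableSet_Icc, integral_Icc_eq_integral_Ioc,
      ← intervalIntegral.integral_of_le (hab x hx).le]
    refine (intervalIntegral.integral_eq_sub_of_hasDerivAt_of_le (hab x hx).le (hcont x hx)
      (hder x hx) ?_).symm
    rw [intervalIntegrable_iff_integrableOn_Icc_of_le (hab x hx).le]; have h' := hxi; rw [hfib_in x hx] at h'; exact (integrable_indicator_iff measurableSet_Icc).mp h'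
  have hgi : IntegrableOn (fun x => F (Fin.snoc x (b x)) - F (Fin.snoc x (a x))) τ := by
    refine Integrable.mono' hG2.integral_norm_prod_left.integrableOn.integrable
      (KZ.aestronglyMeasurable_of_isSemialgebraicFunOn hgsa hτm) ?_
    rw [ae_restrict_iff' hτm]; filter_upwards [hG2.prod_right_ae] with x hx hxτ
    rw [hgx x hxτ hx]; exact norm_integral_le_integral_norm _
  let r' : KZ.IntegralRep N :=
    ⟨τ, fun x => F (Fin.snoc x (b x)) - F (Fin.snoc x (a x)), hτ, hgsa, hgi⟩
  have h23 : KZ.of r₂ - KZ.of r' ∈ KZ.relations :=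
    KZ.newtonLeibnizRel_subset_relations ⟨N, r₂, r', a, b, F, hF, ha, hb,
      fun x hx => (hab x hx).le, rfl, hcont, hder, fun x _ => rfl, rfl⟩
  refine ⟨r', rfl, rfl, ?_⟩; have : KZ.of r - KZ.of r' = (KZ.of r - KZ.of r₂) + (KZ.of r₂ - KZ.of r') := by abel
  rw [this]; exact KZ.relations.add_mem h12 h23

/-- Auxiliary step `mem_simplex_four_iff` (§W5): mem simplex four iff. [bookkeeping] -/
private theorem mem_simplex_four_iff (t : Fin 4 → ℝ) :
    t ∈ KZ.openOrderedSimplex 4 ↔ 0 < t 3 ∧ t 3 < t 2 ∧ t 2 < t 1 ∧ t 1 < t 0 ∧ t 0 < 1 := by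
  constructor
  · rintro ⟨h0, h1, ha⟩
    exact ⟨h0 3, ha (show (2 : Fin 4) < 3 by decide), ha (show (1 : Fin 4) < 2 by decide),
      ha (show (0 : Fin 4) < 1 by decide), h1 0⟩
  · rintro ⟨h3, h32, h21, h10, h0⟩
    have hsa : StrictAnti t := by
      refine Fin.strictAnti_iff_succ_lt.mpr fun i => ?_
      fin_cases i
      · simpa using h10
      · simpa using h21
      · simpa using h32
    exact ⟨fun i => lt_of_lt_of_le h3 (hsa.antitone (Fin.le_last i)),
      fun i => lt_of_le_of_lt (hsa.antitone (Fin.le_iff_val_le_val.2 (Nat.zero_le _))) h0, hsa⟩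

/-- Auxiliary step `abs_det_of_invol4` (§W4): abs det of invol4. [bookkeeping] -/
private theorem abs_det_of_invol4 {L : (Fin 4 → ℝ) →L[ℝ] (Fin 4 → ℝ)} (h : ∀ w, L (L w) = w) : |L.det| = 1 := by
  have hcomp : (L : (Fin 4 → ℝ) →ₗ[ℝ] (Fin 4 → ℝ)) ∘ₗ (L : (Fin 4 → ℝ) →ₗ[ℝ] (Fin 4 → ℝ)) = LinearMap.id := by
    apply LinearMap.ext; intro w; simp [h]
  have h1 := congrArg LinearMap.det hcomp; rw [LinearMap.det_comp, LinearMap.det_id] at h1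
  have h2 : |LinearMap.det (L : (Fin 4 → ℝ) →ₗ[ℝ] (Fin 4 → ℝ))| ^ 2 = 1 := by
    rw [sq_abs, sq, h1]
  exact (pow_eq_one_iff_of_nonneg (abs_nonneg _) two_ne_zero).1 h2

namespace Summit.KontsevichZagierPeriods.KontsevichZagierPeriods.Cruxes.GZNormalFormWThree.GZLadder.LayerFour
open Summit.KontsevichZagierPeriods.KontsevichZagierPeriods.Cruxes.GZNormalFormWThree.GZLadder.RungFour
open Summit.KontsevichZagierPeriods.KontsevichZagierPeriods.Cruxes.GZNormalFormWThree.GZLadder.WlogFour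
open Summit.KontsevichZagierPeriods.KontsevichZagierPeriods.Cruxes.GZNormalFormWThree.GZLadder.MatchFour
open Summit.KontsevichZagierPeriods.KontsevichZagierPeriods.Cruxes.GZNormalFormWThree.GZLadder.GapForm
open Literature.ModelTheory.ExponentialFields (IsSemialgebraic)

open Set MeasureTheory MvPolynomial in
open Literature.NumberTheory.Transcendental in
open Summit.KontsevichZagierPeriods.KontsevichZagierPeriods.Theorems.RootDecompZetaThreeFrontierWordMoves in

open Set MeasureTheory MvPolynomial in
open Literature.NumberTheory.Transcendental in
open Summit.KontsevichZagierPeriods.KontsevichZagierPeriods.Theorems.RootDecompZetaThreeFrontierWordMoves in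

/-- **`∂₃ (P/den(…,γ₃,…,α₀₃,α₁₃)) = ibpQ4(P)/den(…,γ₃+1,…,α₀₃+1,α₁₃+1)`** on the fibres -/
theorem layF_der (P : MvPolynomial (Fin 4) ℚ) (β0 β1 β2 γ1 γ2 γ3 α02 α03 α13 : ℕ) :
    ∀ y ∈ KZ.openOrderedSimplex 3, ∀ t ∈ Ioo 0 (y (Fin.last 2)),
    HasDerivAt (fun s => layF P β0 β1 β2 γ1 γ2 γ3 α02 α03 α13 (Fin.snoc y s))
      (layF (ibpQ4 P γ3 α03 α13) β0 β1 β2 γ1 γ2 (γ3 + 1) α02 (α03 + 1) (α13 + 1) (Fin.snoc y t)) t := by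
  intro y hy t ht; obtain ⟨h2, h21, h10, h0⟩ := (mem_simplex_three_iff y).1 hy; have ht1 : t < y 2 := ht.2; have a0 : y 0 ≠ 0 := by linarith
  have a1 : y 1 ≠ 0 := by linarith
  have a2 : y 2 ≠ 0 := by linarith
  have a3 : (1 : ℝ) - y 1 ≠ 0 := by linarith
  have a4 : (1 : ℝ) - y 2 ≠ 0 := by linarith
  have hu : (1 : ℝ) - t ≠ 0 := by linarith
  have a6 : y 0 - y 2 ≠ 0 := by linarith
  have hv : y 0 - t ≠ 0 := by linarith
  have hw : y 1 - t ≠ 0 := by linarith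
  have hN := hasDerivAt_aeval_snoc4 y t P
  have hE1 : HasDerivAt (fun s : ℝ => (1 - s) ^ γ3) ((γ3 : ℝ) * (1 - t) ^ (γ3 - 1) * (-1)) t :=
    ((hasDerivAt_id t).const_sub 1).pow γ3
  have hE2 : HasDerivAt (fun s : ℝ => (y 0 - s) ^ α03) ((α03 : ℝ) * (y 0 - t) ^ (α03 - 1) * (-1)) t :=
    ((hasDerivAt_id t).const_sub (y 0)).pow α03
  have hE3 : HasDerivAt (fun s : ℝ => (y 1 - s) ^ α13) ((α13 : ℝ) * (y 1 - t) ^ (α13 - 1) * (-1)) t :=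
    ((hasDerivAt_id t).const_sub (y 1)).pow α13
  have hDen := (((hE1.const_mul (y 0 ^ β0 * y 1 ^ β1 * y 2 ^ β2 * (1 - y 1) ^ γ1 * (1 - y 2) ^ γ2)).mul_const
    ((y 0 - y 2) ^ α02)).mul hE2).mul hE3
  have hne : y 0 ^ β0 * y 1 ^ β1 * y 2 ^ β2 * (1 - y 1) ^ γ1 * (1 - y 2) ^ γ2 * (1 - t) ^ γ3 * (y 0 - y 2) ^ α02 * (y 0 - t) ^ α03 *
      (y 1 - t) ^ α13 ≠ 0 :=
    mul_ne_zero (mul_ne_zero (mul_ne_zero (mul_ne_zero (mul_ne_zero (mul_ne_zero (mul_ne_zero (mul_ne_zero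
      (pow_ne_zero _ a0) (pow_ne_zero _ a1)) (pow_ne_zero _ a2)) (pow_ne_zero _ a3)) (pow_ne_zero _ a4)) (pow_ne_zero _ hu))
      (pow_ne_zero _ a6)) (pow_ne_zero _ hv)) (pow_ne_zero _ hw)
  have h := hN.div hDen hne
  show HasDerivAt (fun s => MvPolynomial.aeval (Fin.snoc y s : Fin 4 → ℝ) P /
    (y 0 ^ β0 * y 1 ^ β1 * y 2 ^ β2 * (1 - y 1) ^ γ1 * (1 - y 2) ^ γ2 * (1 - s) ^ γ3 * (y 0 - y 2) ^ α02 * (y 0 - s) ^ α03 *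
      (y 1 - s) ^ α13)) _ t
  refine h.congr_deriv ?_; simp only [Pi.mul_apply]
  rw [Summit.KontsevichZagierPeriods.RootDecompZetaThreeFrontier.WordLayer.natCast_mul_pow_pred γ3 (1 - t) hu,
    Summit.KontsevichZagierPeriods.RootDecompZetaThreeFrontier.WordLayer.natCast_mul_pow_pred α03 (y 0 - t) hv,
    Summit.KontsevichZagierPeriods.RootDecompZetaThreeFrontier.WordLayer.natCast_mul_pow_pred α13 (y 1 - t) hw]
  simp only [layF, ibpQ4, map_add, map_mul, map_sub, map_natCast, MvPolynomial.aeval_X, MvPolynomial.aeval_C, map_one,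
    snoc3_zero, snoc3_one, snoc3_two, snoc3_three]
  field_simp; ring

/-- **THE t₃-IBP MOVE**: `[Δ₄, ibpQ4(P)/den(…,γ₃+1,…,α₀₃+1,α₁₃+1)] ≡ [Δ₃, ibpB4(P)/(y₀^{β₀+α₀₃} y₁^{β₁+α₁₃} y₂^{β₂} (1-y₁)^{γ₁}
(1-y₂)^{γ₂+γ₃} (y₀-y₂)^{α₀₂+α₀₃} (y₁-y₂)^{α₁₃})]` (one Newton–Leibniz move, rule 3, + rule 1 for the band). -/
theorem ibpT3 (P : MvPolynomial (Fin 4) ℚ) (β0 β1 β2 γ1 γ2 γ3 α02 α03 α13 : ℕ) (r : KZ.IntegralRep 4)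
    (hd : r.domain = KZ.openOrderedSimplex 4)
    (hi : EqOn r.integrand (layF (ibpQ4 P γ3 α03 α13) β0 β1 β2 γ1 γ2 (γ3 + 1) α02 (α03 + 1) (α13 + 1)) r.domain) :
    ∃ r' : KZ.IntegralRep 3, r'.domain = KZ.openOrderedSimplex 3 ∧
      EqOn r'.integrand (fun y => MvPolynomial.aeval y (ibpB4 P γ3 α03 α13) /
        (y 0 ^ (β0 + α03) * y 1 ^ (β1 + α13) * y 2 ^ β2 * (1 - y 1) ^ γ1 * (1 - y 2) ^ (γ2 + γ3) * (y 0 - y 2) ^ (α02 + α03) *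
          (y 1 - y 2) ^ α13)) r'.domain ∧
      KZ.of r - KZ.of r' ∈ KZ.relations := by
  obtain ⟨r', hd', hi', hrel⟩ := nlB4 (layF_sa_band (ibpQ4 P γ3 α03 α13) β0 β1 β2 γ1 γ2 (γ3 + 1) α02 (α03 + 1) (α13 + 1))
    (layF_sa_band P β0 β1 β2 γ1 γ2 γ3 α02 α03 α13) (layF_cont P β0 β1 β2 γ1 γ2 γ3 α02 α03 α13)
    (layF_der P β0 β1 β2 γ1 γ2 γ3 α02 α03 α13) r hd hi
  refine ⟨r', hd', fun y hy => ?_, hrel⟩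
  rw [hd'] at hy; obtain ⟨h2, h21, h10, h0⟩ := (mem_simplex_three_iff y).1 hy; have a0 : y 0 ≠ 0 := by linarith
  have a1 : y 1 ≠ 0 := by linarith
  have a2 : y 2 ≠ 0 := by linarith
  have a3 : (1 : ℝ) - y 1 ≠ 0 := by linarith
  have a4 : (1 : ℝ) - y 2 ≠ 0 := by linarith
  have a6 : y 0 - y 2 ≠ 0 := by linarith
  have a7 : y 0 - y 1 ≠ 0 := by linarith
  have a8 : y 1 - y 2 ≠ 0 := by linarith
  rw [hi']
  have e1 : (Fin.snoc y (y (Fin.last 2)) : Fin 4 → ℝ) = ![y 0, y 1, y 2, y 2] := by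
    funext i; fin_cases i <;> rfl
  have e0 : (Fin.snoc y 0 : Fin 4 → ℝ) = ![y 0, y 1, y 2, 0] := by
    funext i; fin_cases i <;> rfl
  have g1 : (fun i => MvPolynomial.aeval y ((![MvPolynomial.X 0, MvPolynomial.X 1, MvPolynomial.X 2, MvPolynomial.X 2] :
      Fin 4 → MvPolynomial (Fin 3) ℚ) i)) = ![y 0, y 1, y 2, y 2] := by
    funext i; fin_cases i <;> simp
  have g0 : (fun i => MvPolynomial.aeval y ((![MvPolynomial.X 0, MvPolynomial.X 1, MvPolynomial.X 2, 0] :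
      Fin 4 → MvPolynomial (Fin 3) ℚ) i)) = ![y 0, y 1, y 2, 0] := by
    funext i; fin_cases i <;> simp
  show layF P β0 β1 β2 γ1 γ2 γ3 α02 α03 α13 (Fin.snoc y (y (Fin.last 2))) -
    layF P β0 β1 β2 γ1 γ2 γ3 α02 α03 α13 (Fin.snoc y 0) = _
  rw [e1, e0]
  simp only [layF, ibpB4, map_sub, map_mul, map_pow, MvPolynomial.aeval_bind₁, g1, g0, MvPolynomial.aeval_X, map_one,
    vec4_0, vec4_1, vec4_2, vec4_3, sub_zero, one_pow, mul_one]
  field_simp; ring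

/-- **THE t₃-IBP ENGINE in route vocabulary**: every `t₃`-exact class `ibpQ4(P)/den(…,γ₃+1,…,α₀₃+1,α₁₃+1)` on `Δ₄` is congruent, by
one Newton–Leibniz move, to ONE genus-zero datum of dimension `3`, hence `CongInto (gzLT 4)`. -/
theorem congInto_of_ibpT3 (P : MvPolynomial (Fin 4) ℚ) (β0 β1 β2 γ1 γ2 γ3 α02 α03 α13 : ℕ) (r : KZ.IntegralRep 4)
    (hd : r.domain = simplex 4)
    (hi : EqOn r.integrand (layF (ibpQ4 P γ3 α03 α13) β0 β1 β2 γ1 γ2 (γ3 + 1) α02 (α03 + 1) (α13 + 1)) r.domain) :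
    CongInto (gzLT 4) (KZ.of r) := by
  obtain ⟨r', hd', hi', hrel⟩ := ibpT3 P β0 β1 β2 γ1 γ2 γ3 α02 α03 α13 r hd hi; have h02 : ((0 : Fin 3) < 2) = True := eq_true (by decide)
  have h12 : ((1 : Fin 3) < 2) = True := eq_true (by decide)
  refine congInto_of_sub_mem hrel (congInto_self ⟨3, r', by norm_num, ⟨hd', ibpB4 P γ3 α03 α13,
    ![![0, 0, α02 + α03], ![0, 0, α13], ![0, 0, 0]], ![β0 + α03, β1 + α13, β2], ![0, γ1, γ2 + γ3], fun y hy => ?_⟩, rfl⟩)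
  rw [hi' hy]
  simp only [Fin.prod_univ_three, Matrix.cons_val_zero, Matrix.cons_val_one, Matrix.head_cons, Matrix.cons_val_two,
    Matrix.tail_cons, h02, h12, if_true, pow_zero, ite_self, mul_one, one_mul]
  ring

/-- the `σ₄`-conjugate of a 9-factor class is a 9-factor class with reflected exponents and numerator `du4P Q = Q ∘ σ₄` -/
theorem layF_du4 (Q : MvPolynomial (Fin 4) ℚ) (β0 β1 β2 γ1 γ2 γ3 α02 α03 α13 : ℕ) (t : Fin 4 → ℝ) :
    layF Q β0 β1 β2 γ1 γ2 γ3 α02 α03 α13 (du4 t) = layF (du4P Q) γ3 γ2 γ1 β2 β1 β0 α13 α03 α02 t := by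
  simp only [layF, aeval_du4P, du4_zero, du4_one, du4_two, du4_three, sub_sub_cancel, sub_sub_sub_cancel_left]; ring

/-- **THE t₀-IBP ENGINE** (§L4 conjugated by `σ₄`): every class `du4P(ibpQ4 P γ₃ α₀₃ α₁₃)/(t₀^{γ₃+1} t₁^{γ₂} t₂^{γ₁} (1-t₁)^{β₂}
(1-t₂)^{β₁} (1-t₃)^{β₀} (t₀-t₂)^{α₁₃+1} (t₀-t₃)^{α₀₃+1} (t₁-t₃)^{α₀₂})` on `Δ₄` is `CongInto (gzLT 4)`. -/
theorem congInto_of_ibpT0 (P : MvPolynomial (Fin 4) ℚ) (β0 β1 β2 γ1 γ2 γ3 α02 α03 α13 : ℕ) (r : KZ.IntegralRep 4)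
    (hd : r.domain = simplex 4)
    (hi : EqOn r.integrand (layF (du4P (ibpQ4 P γ3 α03 α13)) (γ3 + 1) γ2 γ1 β2 β1 β0 (α13 + 1) (α03 + 1) α02) r.domain) :
    CongInto (gzLT 4) (KZ.of r) := by
  refine congInto_of_dual4 _ r hd (congInto_of_ibpT3 P β0 β1 β2 γ1 γ2 γ3 α02 α03 α13 (dualRep4 r hd) rfl fun t ht => ?_)
  rw [dualRep4_integrand, hi (by rw [hd]; exact mem_simplex_four_du4 ht), ← layF_du4, du4_du4]

/-! ### §L5 Newton–Leibniz in the INTERIOR direction `t₂`: the coordinate transposition `u = (t₀,t₁,t₃,t₂)` (rule 2, `|det| = 1`)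
carries `Δ₄` onto the open band `u₂ < u₃ < u₁` over `(u₀,u₁,u₂) ∈ Δ₃`, where `newtonLeibniz_pack4` integrates `u₃ = t₂` out between the
faces `t₂ = t₃` and `t₂ = t₁` (both faces of `Δ₄`, on which the chords restrict to chords).  The transposition preserves the SET of chords, so
the t₂-IBP ENGINE lands in genus-zero data of dimension 3; the t₁-engine is its `σ₄`-conjugate.  With §L4 this gives IBP engines in ALL FOUR
directions. -/

end Summit.KontsevichZagierPeriods.KontsevichZagierPeriods.Cruxes.GZNormalFormWThree.GZLadder.LayerFour
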